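import Summits.CriticalPhenomena.PercolationContinuityZ3.Theorems.PercNearOneGluingNoHeavyQuantCriterionRate
import Summits.CriticalPhenomena.PercolationContinuityZ3.Theorems.PercNearOneGluingNoHeavyQuantUniqZoneCritical
import HarnessLib

/-!
# QUANT lane (R5 S6 → S4/S7 glue): a criterion's uniqueness specifications DOMINATED by the explicit uniqueness scale hold at `p_c`

builds on p205010 (kernel theorem, internal audit signed; external expert review pending)
Memo-level programme; an explicit function tending to 0 and nothing more (README "MAIN LINE", LADDER.md R5).

Cell `prim-quant`, typer seat `prim-quant-stmt` (roster: "`knCriterion_uniqOK_dominated`-shape lemma for p3").  For the lead's interface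
`Quant.SlabCriterion d` (`…QuantCriterionRate.lean`): if every uniqueness specification `(c u m, M u m)` of the criterion has its
outer scale at least the EXPLICIT uniqueness scale `uniqScale d (critDelta d) C.τ (c u m)` of `…QuantUniqZoneCritical.lean`
(`= max(n₁, ⌈c^{1/α}⌉, ⌈(1/τ)^{1/α}⌉)` with DKT's closed-form `α = AKN.dktAlpha d`, `n₁ = AKN.dktN1 d (critDelta d)`), then
`C.UniqAt (criticalProbI d)` — so the S4 instance `knCriterion` only has to choose `M u m ≥ uniqScale …` (a closed-form lower bound)
and the rate assembly `SlabCriterion.oneArm_rate_criticalProbI` applies with no existential constant left.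

* `SlabCriterion.uniqAt_criticalProbI_of_uniqScale_le` — the domination lemma;
* `SlabCriterion.oneArm_rate_criticalProbI_explicit` — `C.Holds` + domination ⇒ `π_{p_c}(N) ≤ (1 - η)^j` for `iterScale j ≤ N`.
-/

noncomputable section

namespace Summit.CriticalPhenomena.PercolationContinuityZ3.Theorems.Quant

open MeasureTheory Literature.Probability.Percolation Literature.Probability.LatticeModels
open Literature.Probability.Percolation.AKN

variable {d : ℕ}

namespace SlabCriterion

/-- **Domination ⇒ uniqueness at `p_c`** (`d ≥ 2`, `0 < C.τ`): if `uniqScale d (critDelta d) C.τ (C.c u m) ≤ C.M u m` for every seed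
`m ≥ m₀` and every uniqueness specification `u < nU`, then `C.UniqAt (criticalProbI d)`.  Proof: `uniqAt_criticalProbI_of_dkt` with the
explicit DKT constants (`dkt_criticalProbI_explicit`) and the three defining properties of `uniqScale` (`dktN1_le_uniqScale`,
`le_floor_rpow_of_uniqScale_le`, `rpow_neg_le_of_uniqScale_le`).  Memo-level programme.
builds on p205010 (kernel theorem, internal audit signed; external expert review pending).
[cite: DuminilcopinKozmaTassion2020, Proposition 1] -/
theorem uniqAt_criticalProbI_of_uniqScale_le [NeZero d] (hd : 2 ≤ d) (C : SlabCriterion d) (hτ : 0 < C.τ)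
    (hM : ∀ m, C.m₀ ≤ m → ∀ u, u < C.nU → uniqScale d (critDelta d) C.τ (C.c u m) ≤ C.M u m) :
    C.UniqAt (criticalProbI d) :=
  C.uniqAt_criticalProbI_of_dkt (dkt_criticalProbI_explicit hd)
    (fun m hm u hu => (dktN1_le_uniqScale d (critDelta d) C.τ (C.c u m)).trans (hM m hm u hu))
    (fun m hm u hu => le_floor_rpow_of_uniqScale_le (hM m hm u hu))
    (fun m hm u hu => rpow_neg_le_of_uniqScale_le hτ (hM m hm u hu))

/-- **Explicit rate at `p_c` from a dominated criterion** (`d ≥ 2`): `C.Holds`, `0 < C.τ` and domination of the uniqueness scales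
give `π_{p_c}(N) ≤ (1 - C.η)^j` whenever `C.iterScale j ≤ N` — `oneArm_rate_criticalProbI` with `UniqAt p_c` discharged by
`uniqAt_criticalProbI_of_uniqScale_le`; no existential constant remains.  Memo-level programme; an explicit function tending to 0
and nothing more.  builds on p205010 (kernel theorem, internal audit signed; external expert review pending).
[cite: KozmaNitzan2024, §4 Theorem 6 (pp. 25–31)] [cite: DuminilcopinKozmaTassion2020, Proposition 1] -/
theorem oneArm_rate_criticalProbI_explicit [NeZero d] (hd : 2 ≤ d) (C : SlabCriterion d) (hC : C.Holds) (hτ : 0 < C.τ)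
    (hM : ∀ m, C.m₀ ≤ m → ∀ u, u < C.nU → uniqScale d (critDelta d) C.τ (C.c u m) ≤ C.M u m)
    {j N : ℕ} (hN : C.iterScale j ≤ N) :
    oneArmProb d (criticalProbI d) N ≤ (1 - C.η) ^ j :=
  C.oneArm_rate_criticalProbI hd hC (C.uniqAt_criticalProbI_of_uniqScale_le hd hτ hM) hN

end SlabCriterion

end Summit.CriticalPhenomena.PercolationContinuityZ3.Theorems.Quant
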